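import Mathlib
import HarnessLib
import Summits.ResolutionOfSingularities.ResolutionOfSingularities.Theorems.WildQuotientsWildQuotientResolutionZ9PeeledTwistedLift

/-!
# ℤ9 SPECIMEN (peeled `𝔸⁴/ℤ9`, char 3), brick Z4T part 3a: the twisted substitution `ψ_T` on the 24
# generators of `I₂₈` (dictionary for the seam `Γ(P_T) ≅ L₀`)
(crux stmt-ResolutionOfSingularities-15640 `WildQuotients.WildQuotientResolution`, line `Sketch`; S1 =
stmt-ResolutionOfSingularities-17941 `CyclicQuotientFourfolds`; chain w45c card-P specimen «peeled 𝔸⁴/ℤ9»,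
variant V-BR, brick Z4T (res-L1-w45c-idea-2 `Z4T-TWIST.md` 75f51c076580e517 §2 «dictionary»,
CHAIN v9.3 §4 «Z4T = stub-2»). [OURS · L1 W4.5c] — NOT a statement of any manuscript; replaces the role of
no printed item; AI-produced, kernel-checked ≠ expert-reviewed. Def-free; letters = res-D-pv-033's
`…Z9PeeledCoverThree` (abstract `g : Fin 24 → k[x]` with the exponent table `hg`).)

For the generator vector `g` of `I₂₈` (the `(7,4,1)`-weight-`≥ 28` monomials `x_a^i x_b^j x_c^l`, table
`e24`) and the twisted substitution `ψ_T` (`x_a ↦ S⁷αu`, `x_b ↦ S⁴u`, `x_c ↦ Sγ`; `…Z9PeeledTwistedLift`):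

* `twist_monomial` — `ψ_T (x_a^i x_b^j x_c^l) = S^{7i+4j+l} · α^i · γ^l · u^{i+j}`;
* **`twist_gens`** — the same for `g q`, `q : Fin 24`;
* (`7i + 4j + l ≥ 28` on the table is res-D-pv-033's `Z9Peeled.weight_e24_ge`, `…Z9PeeledI28Stable` —
  not restated; so `ψ_T (g q) = S²⁸ · (μ₄-weight-0 monomial)`, the chart quotients of the seam);
  `weight_gens_mod_four` — `4 ∣ (7i + 4j + l − 28) + i + 3l` (the `μ₄`-weight `(1,1,3,0)` of
  `S^{7i+4j+l−28} α^i γ^l` vanishes);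
* `twist_N1_pow_seven` — `ψ_T (N₁⁷) = (S³u)²⁸` (`N₁⁷ t³` is the section of the piece `P_T = D₊(N₁⁷t³)`).
The ring identification `(k[x][I₂₈ t])_{(N₁⁷t³)} ≃ L₀` itself (part 3b) consumes these and res-D-pv-033's
single-basic-open form of `P_T`.
-/

-- single-problem summit: the doubled namespace component `ResolutionOfSingularities` is forced
set_option linter.dupNamespace false

noncomputable section

open MvPolynomial

namespace Summit.ResolutionOfSingularities.ResolutionOfSingularities.Theorems.WildQuotientResolution.Z9Peeled

variable (k : Type) [Field k] (n : ℕ) (a b c : Fin n)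

/-- The exponent table of the 24 generators of `I₂₈` (res-D-pv-033's `e24`, verbatim). -/
local notation3 "e24" => (![(4, 0, 0), (3, 2, 0), (3, 1, 3), (3, 0, 7), (2, 4, 0), (2, 3, 2), (2, 2, 6), (2, 1, 10), (2, 0, 14), (1, 6, 0), (1, 5, 1), (1, 4, 5), (1, 3, 9), (1, 2, 13), (1, 1, 17), (1, 0, 21), (0, 7, 0), (0, 6, 4), (0, 5, 8), (0, 4, 12), (0, 3, 16), (0, 2, 20), (0, 1, 24), (0, 0, 28)] : Fin 24 → ℕ × ℕ × ℕ)
/-- `u = 1 − S⁶α²` (local shorthand; slots `S = X b`, `α = X a`). -/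
local notation3 "uT" => (1 - X b ^ 6 * X a ^ 2 : MvPolynomial (Fin n) k)
/-- The twisted substitution `ψ_T` (local shorthand, as in `…Z9PeeledTwistedLift`). -/
local notation3 "twT" => (fun i : Fin n => if i = a then X b ^ 7 * X a * (1 - X b ^ 6 * X a ^ 2)
    else if i = b then X b ^ 4 * (1 - X b ^ 6 * X a ^ 2) else if i = c then X b * X c
    else (X i : MvPolynomial (Fin n) k))

/-- **`ψ_T (x_a^i x_b^j x_c^l) = S^{7i+4j+l} α^i γ^l u^{i+j}`.** [OURS · L1 W4.5c] -/
theorem twist_monomial (hab : a ≠ b) (hac : a ≠ c) (hbc : b ≠ c) (i j l : ℕ) :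
    aeval twT (X a ^ i * X b ^ j * X c ^ l : MvPolynomial (Fin n) k) =
      X b ^ (7 * i + 4 * j + l) * X a ^ i * X c ^ l * uT ^ (i + j) := by
  rw [map_mul, map_mul, map_pow, map_pow, map_pow, twist_X_a, twist_X_b k n a b c hab,
    twist_X_c k n a b c hac hbc]
  generalize (1 - X b ^ 6 * X a ^ 2 : MvPolynomial (Fin n) k) = U
  ring

/-- **`ψ_T (g q) = S^{7i+4j+l} α^i γ^l u^{i+j}`** for the generators `g q = x_a^i x_b^j x_c^l` of `I₂₈`
(`(i,j,l) = e24 q`). [OURS · L1 W4.5c] -/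
theorem twist_gens (hab : a ≠ b) (hac : a ≠ c) (hbc : b ≠ c) (g : Fin 24 → MvPolynomial (Fin n) k)
    (hg : ∀ q, g q = X a ^ (e24 q).1 * X b ^ (e24 q).2.1 * X c ^ (e24 q).2.2) (q : Fin 24) :
    aeval twT (g q) = X b ^ (7 * (e24 q).1 + 4 * (e24 q).2.1 + (e24 q).2.2) * X a ^ (e24 q).1 *
      X c ^ (e24 q).2.2 * uT ^ ((e24 q).1 + (e24 q).2.1) := by
  rw [hg]
  exact twist_monomial k n a b c hab hac hbc _ _ _

/-- The chart quotients `S^{7i+4j+l−28} α^i γ^l` have `μ₄`-weight `(1,1,3)·(7i+4j+l−28, i, l) ≡ 0`: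
`4 ∣ (7i + 4j + l − 28) + i + 3l` on the table. [OURS · L1 W4.5c] -/
theorem weight_gens_mod_four (q : Fin 24) :
    4 ∣ (7 * (e24 q).1 + 4 * (e24 q).2.1 + (e24 q).2.2 - 28) + (e24 q).1 + 3 * (e24 q).2.2 := by
  fin_cases q <;> decide

/-- **`ψ_T (N₁⁷) = (S³u)²⁸`**, `N₁ = x_b(x_b + x_a)(x_b − x_a)`: the section `N₁⁷t³` of the piece
`P_T = D₊(N₁⁷t³)` becomes the 28-th power of the fourth root `S³u`. [OURS · L1 W4.5c] -/
theorem twist_N1_pow_seven (hab : a ≠ b) :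
    aeval twT ((X b * (X b + X a) * (X b - X a)) ^ 7 : MvPolynomial (Fin n) k) = (X b ^ 3 * uT) ^ 28 := by
  rw [map_pow, twist_N1 k n a b c hab, ← pow_mul]

/-! ## The three factors of `N₁` and the chart denominator of `P_T` (appended for the seam, part 3b-iii) -/

/-- `ψ_T (x_b + x_a) = S⁴u·v`, `v = 1 + S³α`. [OURS · L1 W4.5c] -/
theorem twist_X_b_add_X_a (hab : a ≠ b) :
    aeval twT (X b + X a : MvPolynomial (Fin n) k) = X b ^ 4 * uT * (1 + X b ^ 3 * X a) := by
  rw [map_add, twist_X_a, twist_X_b k n a b c hab]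
  ring

/-- `ψ_T (x_b − x_a) = S⁴u·v'`, `v' = 1 − S³α`. [OURS · L1 W4.5c] -/
theorem twist_X_b_sub_X_a (hab : a ≠ b) :
    aeval twT (X b - X a : MvPolynomial (Fin n) k) = X b ^ 4 * uT * (1 - X b ^ 3 * X a) := by
  rw [map_sub, twist_X_a, twist_X_b k n a b c hab]
  ring

/-- **The chart denominator of `P_T` becomes `u`**: `ψ_T ((x_b + x_a)(x_b − x_a)) = S⁸·u³` while
`ψ_T (x_b²) = S⁸·u²` — so on the `x_b`-vertex chart the element `1 − A²`, `A = x_a/x_b`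
(`P_T = D₊(x_b⁷t) ∩ {1 − A² invertible}`), maps to `u` (res-L1-w45c-stub-2 `Z4T-PART3-DESIGN.md`, Addendum 2).
[OURS · L1 W4.5c] -/
theorem twist_normFactor (hab : a ≠ b) :
    aeval twT ((X b + X a) * (X b - X a) : MvPolynomial (Fin n) k) = X b ^ 8 * uT ^ 3 := by
  rw [map_mul, twist_X_b_add_X_a k n a b c hab, twist_X_b_sub_X_a k n a b c hab]
  ring

/-- `ψ_T (x_b²) = S⁸·u²`. [OURS · L1 W4.5c] -/
theorem twist_X_b_sq (hab : a ≠ b) :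
    aeval twT (X b ^ 2 : MvPolynomial (Fin n) k) = X b ^ 8 * uT ^ 2 := by
  rw [map_pow, twist_X_b k n a b c hab]
  ring

end Summit.ResolutionOfSingularities.ResolutionOfSingularities.Theorems.WildQuotientResolution.Z9Peeled

end
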